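import Literature.MathematicalPhysics.QuantumFieldTheory.Balaban1983to89.B9B8KnitBondWordDiffAtParsReg335
import Literature.MathematicalPhysics.QuantumFieldTheory.Balaban1983to89.B9Thm33DeltaATransferOfMajorants
import Literature.MathematicalPhysics.QuantumFieldTheory.Balaban1983to89.B9Thm33KnitJunctionWindows
import Literature.MathematicalPhysics.QuantumFieldTheory.Balaban1983to89.B9Thm310DeltaAIsUnitOfRegYP335AtLettersY
import Literature.MathematicalPhysics.QuantumFieldTheory.Balaban1983to89.B8Thm2TorusCoverOfEBlockSymG
import Literature.MathematicalPhysics.QuantumFieldTheory.Balaban1983to89.B9Thm32CinvAtMemberOfCubeDataThmD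
import Literature.MathematicalPhysics.QuantumFieldTheory.Balaban1983to89.B9GeoInputsMultiRateKLevelV1
import Literature.MathematicalPhysics.QuantumFieldTheory.Balaban1983to89.B9Eq3105FamThreeAtMember
import Literature.MathematicalPhysics.QuantumFieldTheory.Balaban1983to89.B9Thm311PosDefQknitAtKnitSiteTableY
import Literature.MathematicalPhysics.QuantumFieldTheory.Balaban1983to89.B9CubeLettersInvReadDictBMajorants

/-!
# `Balaban1983to89.B9Thm33DeltaAAtKnitLetterOfRegYP335` — T. Bałaban, *Propagators for lattice gauge theories in a background field*, Commun. Math. Phys. **99**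
# (1985) 389–434 [Balaban1985BackgroundPropagators], THEOREM 3.3 p. 399 («Under the assumptions of Theorem 3.1 … the operator G(U) satisfies (3.42)») FOR
# `G(U) = Δ_a(U)⁻¹` AT PRINT's OWN KNIT TRANSPORTERS `parKnitY` ((3.19) p. 393 «(52), (53) in [5]»), ON PRINT's CLASS (3.35) p. 396, FOR EVERY SECTION-CARRYING MEMBER
# ABOVE ONE THRESHOLD: `Δ_a(U; parKnitY)` IS INVERTIBLE and its inverse has the (3.42)₁ block majorant `C_K·ℓ(a)²·e^{−δ_Kd}` — the ONE displayed law of the N06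
# certificate's row 17 at the knit record (`B9Thm311PosDefQknitAtKnitSiteTableY.symm_posDefTr_deltaAQY_knitRecord_of_block_regYR`) in majorant currency

statement-level skeleton of published theorems with citation tags; proofs where landed; nothing here is a claim about the Yang–Mills mass gap

THE PRINT.  Thm 3.3 p. 399; Thm 3.1 (3.42) p. 397; Thm 3.2 (3.48) p. 398; (3.19) p. 393 (the knit transporters); (3.25)–(3.27) pp. 394–395; (3.35)–(3.37) p. 396; (3.49)
p. 399; (3.69) p. 404; Cor. 3.6 p. 408; Thm 3.10 (3.105)–(3.106) pp. 414–416 («G = G₀(I − R)⁻¹»); [4] Prop. 2.2 (2.50)–(2.52) p. 232, Lemma 2.1 (2.59)–(2.63)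
pp. 233–234, (2.66)–(2.67) p. 234; [5] Prop. 2 (52)–(53) p. 26, (44) p. 24.

WHY THIS FILE (cell `pub-ymgap`, node N06, seat `dag-n06-j` gen 36 = bundle F5 row 17; lit-balaban lead g41 DESK PRE-LOCATION 2026-08-30).  The tree has Thm 3.3's block
at def-Y's letter of record for every section-carrying member of (3.35) (`B9Thm310DeltaAIsUnitOfRegYP335AtLettersY`, from lit-balaban's ASM2), Thm 3.1 ∕ 3.2 for `G′`,
`(Q′G′²Q′*)⁻¹` at that letter from the same per-cube (3.35) datum (FILE 9 `eBlock_GpY_of_cubeData_unitary`, FILE 10-D `cinv_at_member_of_cubeData_thmD`), and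
(files 1–7 of this chain) the bond-sector knit junction ON (3.35): `conj b((D_UP_SD*_U − D_UP_KD*_U)^ℝ) ≺ κ_J·ℓ⁻²·e^{−ρd}` with `κ_J = O(α₀′)`
(`B9B8KnitBondWordDiffAtParsReg335`) and the letter-free transfer at the `Δ_a` level (`B9Thm33DeltaATransferOfMajorants`).  THIS FILE assembles them at
the member: the cube datum of the class on the balls `NearC_□(35S_j∕8 + 1)` (n06-j `reg335Cube_nearC_of_reg335P` + p33 `exists_cubeData_of_reg335Cubes`), the
junction parameter FIXED at `α₀′ := a₀K` (the minimum of [5]'s `α_Q` and the three windows of `B9Thm33KnitJunctionWindows` — member-free), the knit numerics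
`K_pl(Mα₀)L⁴ < a₀K` folded into the guard `M·α₀ ≤ a₁` (`Kpl_lt_of_le`, `plaqConst_le_of_le_one`), the rate ladder chosen once; every real constant of the
assembly is an OPAQUE ATOM with a defining equation (file 6's constants are passed by name, no `B6.c1` literal is ever unfolded; `maxHeartbeats 4000000` for the
one long assembly, as in the cell's other member assemblies)
(`δ₀ = min(δ_G, δ_T, δ_A)`, all fractions `¼`, `α_g = ½`), [4] Lemma 2.1 and the scale transfers above one threshold (`geo_inputs3_geo9K`, `transferL_geo9K`).

WHAT IS PROVED (sorry-free; 0 `def`).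
* §0 `scaleTransfer_len_sq_geo9K` (the transfer of `ℓ²`, `transferL_geo9K` at `q = 2`), `log_le_rate_mul` (one threshold serves every transfer), `Kpl_lt_of_le`.
* §1 ★★★ **`isUnit_deltaAY_parKnitY_and_majorant_of_regYP335_section`** — `∃ M₁ a₁ δ_K C_K (M₁, a₁, δ_K > 0, C_K ≥ 0), ∀ x, Surjective β → M₁ ≤ M → ∀ α₀ > 0,
  M·α₀ ≤ a₁ → ∀ U ∈ (bg9YP 𝕄 SU(N) x).Reg335 c₃₅ α₀, IsUnit (deltaAY x.toKIdx parKnitY parBY (GpY parKnitY) U) ∧ ∀ ιB section,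
  conj b(G(U; parKnitY)^ℝ) ≺ C_K·ℓ(a)²·e^{−δ_Kd}` over `(toB6 (geo9K x) 0 True, ιB∘blkV1)` (`b = basis39`).
HONEST SCOPE.  COMPOSITION of landed theorems with threshold ∕ rate ∕ window bookkeeping; no estimate of [B9] newly asserted; (3.42)₁ entry only (the sup block
of `G` itself — what the N06 row-17 gap consumes), not the gradient ∕ Hölder ∕ `L²` companions; members WITHOUT a section (inner corners) are outside; DESIGN
constants; count-neutral; NOT a node discharge; nothing continuum ∕ OS ∕ mass gap ∕ Clay — the Yang–Mills mass gap is NOT proved here.  No `sorry`, no `axiom`, no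
`instance`, no `notation`, no `def`.  NEW file.
RELATED, NOT DUPLICATED (searched 2026-08-30: `rg -l -w "DeltaAAtKnitLetterOfRegYP335|isUnit_deltaAY_parKnitY_and_majorant"` over `lean/Literature` = ∅): n06-j g31
`B9Thm310DeltaAIsUnitOfRegYP335AtLettersY` (the block at `parSymY`, USED), lit-balaban `B9KnitMajorantsOfCubeData` (Thm 3.1∕3.2 letters at the knit letter under the
GLOBAL (52) — torus members), `B8Thm2TorusCoverOfEBlockSymJ.deltaAFour_of_eBlockSymData` (the torus chain's Δ_a-side members at the knit letter under (52), (3.41)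
weighted norms), n06-j g35 `B9Thm311PosDefQknitAtKnitSiteTableY` (the consumer, displays this block).
-/

noncomputable section

namespace Literature.MathematicalPhysics.QuantumFieldTheory.Balaban1983to89.B9Thm33DeltaAAtKnitLetterOfRegYP335

open Literature.MathematicalPhysics.QuantumFieldTheory.Balaban1983to89
open B6RandomWalk B9Thm39ReadingCoords B9Thm39ReadingAtLetters Node00
open B6KLevelCensusIndexV1 B6Ineq2142KLevelV1 B6GlobalChartV1 B9PinMembersKLevelV1 B9PinGeometryKLevelV1 B9GeoNormsKLevelV1
  B9BackgroundsKLevelV1 B9BackgroundsKLevelV1P B9Thm34Ext B9Conv348OfRegYP335AtLettersY B9Thm310DeltaAIsUnitOfRegYP335AtLettersY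
open Literature.MathematicalPhysics.QuantumFieldTheory.Balaban1983to89.B6MultiLevelBoxOperator (bigSide N0)
open Literature.MathematicalPhysics.QuantumFieldTheory.Balaban1983to89.B6Cover236MultiLevelBlocks (cubes)
open Literature.MathematicalPhysics.QuantumFieldTheory.Balaban1983to89.B9Eq335RegularityClasses (Reg335Cube)
open Literature.MathematicalPhysics.QuantumFieldTheory.Balaban1983to89.LatticeNorms (scaleLen)
open Literature.MathematicalPhysics.QuantumFieldTheory.Balaban1983to89.B9Cor36CubeCutoffs (NearC SC)
open Literature.MathematicalPhysics.QuantumFieldTheory.Balaban1983to89.B4PartitionUnity22 (thetaProf D1 D1_nonneg contDiff_thetaProf hasCompactSupport_thetaProf)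
open Literature.MathematicalPhysics.QuantumFieldTheory.Balaban1983to89.B9Eq39Adjoint (fluct covD)
open Literature.MathematicalPhysics.QuantumFieldTheory.Balaban1983to89.B9Eq360DeltaPrimeAY (AfldY)
open Literature.MathematicalPhysics.QuantumFieldTheory.Balaban1983to89.B9FromB6 (EBlock)
open Literature.MathematicalPhysics.QuantumFieldTheory.Balaban1983to89.B9CubeLettersInvReadings (kernelFamilyBInv)
open Literature.MathematicalPhysics.QuantumFieldTheory.Balaban1983to89.B9Thm39OneCubeReadingAtLettersY (geo9Y_M_nonneg)
open Literature.MathematicalPhysics.QuantumFieldTheory.Balaban1983to89.B9Ineq347 (ScaleTransfer)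
open Literature.MathematicalPhysics.QuantumFieldTheory.Balaban1983to89.B9Eq352DivFormLetters (conj conj_sub conj_neg)
open Literature.MathematicalPhysics.QuantumFieldTheory.Balaban1983to89.B9Cor35GpCubeInputsAtOne (hasMajorant_neg)
open Literature.MathematicalPhysics.QuantumFieldTheory.Balaban1983to89.B9GeoLemma21KLevelV1 (geo9K_len_pos transferL_geo9K geo9K_one_le_L)
open Literature.MathematicalPhysics.QuantumFieldTheory.Balaban1983to89.B9GeoInputsMultiRateKLevelV1 (geo_inputs3_geo9K)
open Literature.MathematicalPhysics.QuantumFieldTheory.Balaban1983to89.B9RWSums347DefiniteFaces (exp261)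
open Literature.MathematicalPhysics.QuantumFieldTheory.Balaban1983to89.B9Eq3105FamThreeAtMember (scaleTransfer_len_inv_pow_geo9K)
open Literature.MathematicalPhysics.QuantumFieldTheory.Balaban1983to89.B9Cor36GCubeLocDefectAtLocCfg (scaleTransfer_len_geo9K)
open Literature.MathematicalPhysics.QuantumFieldTheory.Balaban1983to89.B9RWSums347DefiniteFacesWindow (scaleTransfer_mono_const scaleTransfer_congr)
open Literature.MathematicalPhysics.QuantumFieldTheory.Balaban1983to89.B9Cor36GpCoverBindersUnitary (eBlock_GpY_of_cubeData_unitary exists_cubeData_of_reg335Cubes)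
open Literature.MathematicalPhysics.QuantumFieldTheory.Balaban1983to89.B9Thm32CinvAtMemberOfCubeDataThmD (cinv_at_member_of_cubeData_thmD)
open Literature.MathematicalPhysics.QuantumFieldTheory.Balaban1983to89.B8Thm2TorusCoverOfEBlockSymG (symData_of_eBlockS)
open Literature.MathematicalPhysics.QuantumFieldTheory.Balaban1983to89.B9CubeLettersInvReadDictBMajorants (hasMajorant_conj_G_of_eBlockInvB)
open Literature.MathematicalPhysics.QuantumFieldTheory.Balaban1983to89.B9B8KnitLetterXDiffMajorant (hasMajorant_rate_mono)
open Literature.MathematicalPhysics.QuantumFieldTheory.Balaban1983to89.B9B8KnitBondResolvent (deltaAY_sub_deltaAY_eq_DPDsY_sub)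
open Literature.MathematicalPhysics.QuantumFieldTheory.Balaban1983to89.B9Eq3104CutoffCommutators (DPDsY)
open Literature.MathematicalPhysics.QuantumFieldTheory.Balaban1983to89.B9B8KnitBondWordDiffAtParsReg335 (hasMajorant_conj_DPDsY_sub_pars_reg335)
open Literature.MathematicalPhysics.QuantumFieldTheory.Balaban1983to89.B9Thm33DeltaATransferOfMajorants (isUnit_and_hasMajorant_GAY_of_majorants)
open Literature.MathematicalPhysics.QuantumFieldTheory.Balaban1983to89.B9Thm33KnitJunctionWindows (le_half_of_le_window window_AK_BX thetaF_le window_KK_B1 kappaJ_le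
  lt_one_of_le_window)
open Literature.MathematicalPhysics.QuantumFieldTheory.Balaban1983to89.B9Eq316AveragingTransposeZd (alphaQ alphaQ_pos C0_mul_alphaQ_le four_mul_alphaQ_le)
open Literature.MathematicalPhysics.QuantumFieldTheory.Balaban1983to89.B9C2FormBoxRegimeY (Kpl)
open scoped Matrix.Norms.L2Operator

/-! ## §0 Geometry and numerics helpers -/

section Helpers

variable {d ℓ : ℕ} {hd : 1 ≤ d + 1} {hL : Odd (ℓ + 1) ∧ 1 < ℓ + 1} {b₀ b₁ : ℝ}

/-- ★ **SCALE TRANSFER FOR THE WEIGHT `(Lʲη)²`**: under `2·log L ≤ αδ(2L²−1)M` (`αδ > 0`), `e^{−αδd(y,y′)}(L^{j′}η)² ≤ L²(Lʲη)²` (`transferL_geo9K` at `q = 2`).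
[cite: Balaban1985BackgroundPropagators, p.398 remark after (3.47); Balaban1984PropagatorsII, Lemma 2.1 (2.60) p.234] -/
theorem scaleTransfer_len_sq_geo9K (i : KIdx d ℓ hd hL b₀ b₁) {δ α : ℝ} (hε : 0 < α * δ)
    (hM : (2 : ℝ) * Real.log ((ℓ : ℝ) + 1) ≤ α * δ * (2 * ((ℓ : ℝ) + 1) ^ 2 - 1) * (geo9K i).M) :
    ScaleTransfer (geo9K i) δ α (((ℓ : ℝ) + 1) ^ 2) (fun a => (geo9K i).len a ^ 2) := by
  have geo9K_L_eq : (geo9K i).L = (ℓ : ℝ) + 1 := by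
    show (((ℓ + 1 : ℕ) : ℝ)) = (ℓ : ℝ) + 1
    push_cast; ring
  have hn : |(2 : ℝ)| = 2 := abs_of_pos (by norm_num)
  have hq : |(2 : ℝ)| * Real.log (geo9K i).L ≤ α * δ * (2 * ((ℓ : ℝ) + 1) ^ 2 - 1) * (geo9K i).M := by rw [hn, geo9K_L_eq]; exact hM
  have hT := transferL_geo9K i hε (2 : ℝ) hq
  have hC : (geo9K i).L ^ |(2 : ℝ)| = ((ℓ : ℝ) + 1) ^ 2 := by rw [hn, geo9K_L_eq]; exact Real.rpow_two _
  have e : ∀ y : (geo9K i).Site, (geo9K i).len y ^ (2 : ℝ) = (geo9K i).len y ^ 2 := fun y => Real.rpow_two _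
  intro y y'
  have h := hT y y'
  rw [e, e, hC] at h
  have hE : 0 < Real.exp (α * δ * (geo9K i).dist y y') := Real.exp_pos _
  rw [Real.exp_neg, inv_mul_le_iff₀ hE]
  calc (geo9K i).len y' ^ 2 ≤ ((ℓ : ℝ) + 1) ^ 2 * Real.exp (α * δ * (geo9K i).dist y y') * (geo9K i).len y ^ 2 := h
    _ = Real.exp (α * δ * (geo9K i).dist y y') * (((ℓ : ℝ) + 1) ^ 2 * (geo9K i).len y ^ 2) := by ring

/-- one threshold serves every scale transfer: `n·log L ≤ ¼·r·(2L²−1)·M` for `n ≤ 4`, `r ≥ r₀ > 0` once `16·log L ≤ ¼·r₀·(2L²−1)·M`.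
[cite: Balaban1984PropagatorsII, (2.59) p.233 («for RM satisfying (2.59)»), bookkeeping] -/
theorem log_le_rate_mul {Lr r r₀ M n : ℝ} (hL : 0 ≤ Real.log Lr) (hP : 0 ≤ 2 * Lr ^ 2 - 1) (hM0 : 0 ≤ M) (hr : r₀ ≤ r) (hn : n ≤ 4)
    (hthr : 16 * Real.log Lr ≤ 1 / 4 * r₀ * (2 * Lr ^ 2 - 1) * M) : n * Real.log Lr ≤ 1 / 4 * r * (2 * Lr ^ 2 - 1) * M := by
  have h1 : n * Real.log Lr ≤ 4 * Real.log Lr := mul_le_mul_of_nonneg_right hn hL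
  have h2 : 1 / 4 * r₀ * (2 * Lr ^ 2 - 1) * M ≤ 1 / 4 * r * (2 * Lr ^ 2 - 1) * M :=
    mul_le_mul_of_nonneg_right (mul_le_mul_of_nonneg_right (by linarith) hP) hM0
  nlinarith

/-- the knit numerics from the guard: for `0 ≤ t ≤ 1∕(10L)` and `40e⁴L⁵·t < a`, `K_pl(t)·L⁴ < a` (`K_pl(t) = 2(10Lt)(1+10Lt)e^{40Lt} ≤ 4e⁴·10Lt`).
[cite: Balaban1985BackgroundPropagators, (3.69) p.404, (3.35) p.396; Balaban1985Averaging, (52) p.26, bookkeeping] -/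
theorem Kpl_lt_of_le (i : KIdx d ℓ hd hL b₀ b₁) {t a : ℝ} (ht : 0 ≤ t) (ht1 : 10 * (kGeo i).L * t ≤ 1)
    (hta : 40 * Real.exp 4 * (kGeo i).L ^ 5 * t < a) : Kpl i t * (kGeo i).L ^ 4 < a := by
  have hL0 : (0 : ℝ) < (kGeo i).L := by rw [show (kGeo i).L = ((ℓ + 1 : ℕ) : ℝ) from rfl]; positivity
  have hK0 : 0 ≤ 10 * (kGeo i).L * t := by positivity
  have h := plaqConst_le_of_le_one hK0 ht1
  unfold Kpl
  have hL4 : 0 < (kGeo i).L ^ 4 := by positivity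
  calc 2 * (10 * (kGeo i).L * t) * (1 + 10 * (kGeo i).L * t) * Real.exp (4 * (10 * (kGeo i).L * t)) * (kGeo i).L ^ 4
      ≤ 4 * Real.exp 4 * (10 * (kGeo i).L * t) * (kGeo i).L ^ 4 := mul_le_mul_of_nonneg_right h hL4.le
    _ = 40 * Real.exp 4 * (kGeo i).L ^ 5 * t := by ring
    _ < a := hta

end Helpers

/-! ## §1 ★★★ Theorem 3.3's block at the knit letter on (3.35) -/

section Record

open B7Prop2SpecialUnitary

variable {N : ℕ} (θ : Stage3Params) (Mstar : ℕ)

set_option maxHeartbeats 4000000 in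
/-- ★★★ **THEOREM 3.3 AT PRINT's KNIT TRANSPORTERS ON PRINT's CLASS (3.35), FOR EVERY SECTION-CARRYING MEMBER ABOVE ONE THRESHOLD**: there are `M₁, a₁, δ_K > 0`,
`C_K ≥ 0` such that for every member `x` with `β` onto and `M₁ ≦ M`, every `α₀ > 0` with `M·α₀ ≦ a₁`, every `SU(N)`-valued `U ∈ (bg9YP … x).Reg335 c₃₅ α₀`:
`Δ_a(U; parKnitY) = deltaAY x.toKIdx parKnitY parBY (GpY parKnitY) U` IS A UNIT and, for every section `ιB` of `β`, its inverse `G(U; parKnitY)` satisfies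
`conj b(G^ℝ) ≺ C_K·ℓ(a)²·e^{−δ_K·d(a,a′)}` over `(toB6 (geo9K x) 0 True, ιB∘blkV1)`, `b = basis39`.  ROAD: Thm 3.3's block at `parSymY` (n06-j g31) + the
bond-sector knit junction on (3.35) (files 1–6: `κ_J ≤ a₀K·J⋆`-small difference majorant) + the letter-free transfer (file 7), at the junction parameter
`α₀′ := a₀K` fixed below [5]'s `α_Q` and the three windows (file 8a).  Every real constant is an opaque atom with a defining equation (no `B6.c1` literal is
ever unfolded).
[cite: Balaban1985BackgroundPropagators, Thm 3.3 p.399, (3.42) p.397, (3.19) p.393, (3.25)–(3.27) pp.394–395, (3.35) p.396, Thm 3.10 (3.105)–(3.106) pp.414–416, Cor. 3.6 p.408; Balaban1984PropagatorsII, Prop. 2.2 (2.50)–(2.52) p.232, Lemma 2.1 (2.59)–(2.63) pp.233–234, (2.66)–(2.67) p.234; Balaban1985Averaging, Prop. 2 (52)–(53) p.26, (44) p.24] -/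
theorem isUnit_deltaAY_parKnitY_and_majorant_of_regYP335_section [∀ i' : KIdx θ.d₆ θ.ℓ₆ θ.hd' θ.hL' θ.b₀ θ.b₁, Fintype (geo9K i').Site]
    [∀ i' : KIdx θ.d₆ θ.ℓ₆ θ.hd' θ.hL' θ.b₀ θ.b₁, DecidableEq (geo9K i').Site] (hN : 1 ≤ N) :
    ∃ M₁ a₁ δK CK : ℝ, 0 < M₁ ∧ 0 < a₁ ∧ 0 < δK ∧ 0 ≤ CK ∧
    ∀ (x : MemberY θ.d₆ θ.ℓ₆ θ.hd' θ.hL' θ.b₀ θ.b₁ Mstar), Function.Surjective (β x.hN x.D x.hk) → M₁ ≤ (geo9Y x).M →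
      ∀ α₀ : ℝ, 0 < α₀ → (geo9Y x).M * α₀ ≤ a₁ →
      ∀ U : CfgY (Matrix (Fin N) (Fin N) ℂ) x.toKIdx,
        (bg9YP (Matrix (Fin N) (Fin N) ℂ) (specialUnitaryUnits (Fin N)) x).Reg335 c35Y α₀ U →
        IsUnit (deltaAY x.toKIdx (B9B8AveragingJunction.parKnitY x.toKIdx) (parBY x.toKIdx) (GpY x.toKIdx (B9B8AveragingJunction.parKnitY x.toKIdx)) U) ∧
        ∀ (ιB : BlkY x.toKIdx → IBondY x.toKIdx), (∀ s, β x.hN x.D x.hk (ιB s) = s) →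
          HasMajorant (g := toB6 (geo9K x.toKIdx) 0 True) (fun p : FBondY x.toKIdx × κ39 (Matrix (Fin N) (Fin N) ℂ) => ιB (blkV1 x.hN x.D p.1))
            (conj (basis39 (Matrix (Fin N) (Fin N) ℂ))
              ((GAY x.toKIdx (B9B8AveragingJunction.parKnitY x.toKIdx) (parBY x.toKIdx) (GpY x.toKIdx (B9B8AveragingJunction.parKnitY x.toKIdx)) U).restrictScalars ℝ))
            (fun a a' => CK * (geo9K x.toKIdx).len a ^ 2 * Real.exp (-(δK * (geo9K x.toKIdx).dist a a'))) := by
  classical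
  haveI : NeZero N := ⟨by omega⟩
  haveI : Nonempty (Fin N) := ⟨⟨0, hN⟩⟩
  have hGU : specialUnitaryUnits (Fin N) ≤ B7Prop2Explicit.unitaryUnits (Matrix (Fin N) (Fin N) ℂ) := specialUnitaryUnits_le_unitaryUnits
  have hG1 : ∀ u : (Matrix (Fin N) (Fin N) ℂ)ˣ, u ∈ specialUnitaryUnits (Fin N) → ‖(u : Matrix (Fin N) (Fin N) ℂ)‖ ≤ 1 :=
    fun u hu => (B9Ineq349SiteFromConv342.contractive_of_mem hGU hu).1
  -- the basis of record and its coordinate bound (an opaque atom `M₂`)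
  obtain ⟨M₂, hM₂def⟩ : ∃ t : ℝ, t = coordBound39 (basis39 (Matrix (Fin N) (Fin N) ℂ)) := ⟨_, rfl⟩
  have hM₂ : 0 ≤ M₂ := by rw [hM₂def]; exact norm_nonneg _
  have hrepr : ∀ (v : Matrix (Fin N) (Fin N) ℂ) (j : κ39 (Matrix (Fin N) (Fin N) ℂ)),
      |(basis39 (Matrix (Fin N) (Fin N) ℂ)).repr v j| ≤ M₂ * ‖v‖ :=
    fun v j => by rw [hM₂def]; exact abs_repr_le (basis39 (Matrix (Fin N) (Fin N) ℂ)) v j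
  have hSb : 0 ≤ ∑ j, ‖basis39 (Matrix (Fin N) (Fin N) ℂ) j‖ := Finset.sum_nonneg fun _ _ => norm_nonneg _
  set κ : ℝ := M₂ * ∑ j, ‖basis39 (Matrix (Fin N) (Fin N) ℂ) j‖ with hκdef
  have hκ0 : 0 ≤ κ := mul_nonneg hM₂ hSb
  -- ═══ the three suppliers at def-Y's letter (member-free packages) ═══
  obtain ⟨M₁A, a₁A, δA, KA, hM₁A, ha₁A, hδA, hKA, HA⟩ := isUnit_deltaAY_and_eBlock_of_regYP335_section (N := N) θ Mstar hN
  obtain ⟨δG, KG, M₀G, T₀G, N₀G, hδG, hKG, a₁G, ha₁G, HG⟩ := eBlock_GpY_of_cubeData_unitary (basis39 (Matrix (Fin N) (Fin N) ℂ)) hGU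
    (fun _ : KIdx θ.d₆ θ.ℓ₆ θ.hd' θ.hL' θ.b₀ θ.b₁ => (0 : ℝ)) (fun _ => True) θ.one_le_ℓ₆ hM₂ hrepr
  obtain ⟨δT, KT, M₀T, T₀T, N₀T, hδT, hKT, a₁T, ha₁T, HT⟩ := cinv_at_member_of_cubeData_thmD (basis39 (Matrix (Fin N) (Fin N) ℂ)) hGU
    (fun _ : KIdx θ.d₆ θ.ℓ₆ θ.hd' θ.hL' θ.b₀ θ.b₁ => (0 : ℝ)) (fun _ => True) θ.one_le_ℓ₆ hM₂ hrepr
  -- ═══ constants ═══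
  set L : ℝ := (θ.ℓ₆ : ℝ) + 1 with hLdef
  have hL1 : 1 ≤ L := by rw [hLdef]; have : (0:ℝ) ≤ θ.ℓ₆ := Nat.cast_nonneg _; linarith
  have hL0 : 0 < L := lt_of_lt_of_le one_pos hL1
  have hlogL : 0 ≤ Real.log L := Real.log_nonneg hL1
  have hPL : 0 ≤ 2 * L ^ 2 - 1 := by nlinarith
  have hPL' : 0 < 2 * L ^ 2 - 1 := by nlinarith
  set Dd : ℝ := ((θ.d₆ : ℝ) + 1) ^ 2 with hDd
  have hDd0 : 0 ≤ Dd := by positivity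
  set A : ℝ := κ * KG with hAdef
  have hA0 : 0 ≤ A := mul_nonneg hκ0 hKG
  set BG : ℝ := κ * KA with hBGdef
  have hBG0 : 0 ≤ BG := mul_nonneg hκ0 hKA
  -- ═══ the rate ladder (every fraction `¼`, `α_g = ½`); the base rate is an opaque atom ═══
  obtain ⟨δ₀, hδ₀def⟩ : ∃ t : ℝ, t = min δG (min δT δA) := ⟨_, rfl⟩
  have hδ₀ : 0 < δ₀ := by rw [hδ₀def]; exact lt_min hδG (lt_min hδT hδA)
  have hδ₀G : δ₀ ≤ δG := by rw [hδ₀def]; exact min_le_left _ _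
  have hδ₀T : δ₀ ≤ δT := by rw [hδ₀def]; exact (min_le_right _ _).trans (min_le_left _ _)
  have hδ₀A : δ₀ ≤ δA := by rw [hδ₀def]; exact (min_le_right _ _).trans (min_le_right _ _)
  set δ : ℝ := δ₀ / 2 with hδdef
  set δ₁ : ℝ := (1 - 1 / 4) * ((1 - 1 / 4) * δ) with hδ₁def
  set δ₂ : ℝ := (1 - 1 / 4) * ((1 - 1 / 4) * δ₁) with hδ₂def
  set δ₃ : ℝ := (1 - 1 / 4) * ((1 - 1 / 4) * δ₂) with hδ₃def
  set δc : ℝ := (1 - 1 / 4) * δ₃ / 2 with hδcdef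
  set ρ : ℝ := δc / 4 with hρdef
  have hδc_eq : δc = 3 ^ 7 / 4 ^ 8 * δ₀ := by rw [hδcdef, hδ₃def, hδ₂def, hδ₁def, hδdef]; ring
  have hδ : 0 < δ := by positivity
  have hδ₁ : 0 < δ₁ := by positivity
  have hδ₂ : 0 < δ₂ := by positivity
  have hδ₃ : 0 < δ₃ := by positivity
  have hδc : 0 < δc := by positivity
  have hρ : 0 < ρ := by positivity
  -- ═══ [4] Lemma 2.1 at the nine rate pairs, above one threshold (three calls) ═══
  obtain ⟨MLA, hgeoA⟩ := geo_inputs3_geo9K (fun _ : KIdx θ.d₆ θ.ℓ₆ θ.hd' θ.hL' θ.b₀ θ.b₁ => (0 : ℝ)) (fun _ => True)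
    (δ₁ := δc) (α₁ := 1 / 4) (δ₂ := (1 - 1 / 4) * δ) (α₂ := 1 / 4) (δ₃ := δ₀) (α₃ := 1 / 2)
    (by positivity) (by positivity) (by positivity) hδ₀.le (by norm_num)
  obtain ⟨MLB, hgeoB⟩ := geo_inputs3_geo9K (fun _ : KIdx θ.d₆ θ.ℓ₆ θ.hd' θ.hL' θ.b₀ θ.b₁ => (0 : ℝ)) (fun _ => True)
    (δ₁ := (1 - 1 / 4) * δ₁) (α₁ := 1 / 4) (δ₂ := (1 - 1 / 4) * δ₂) (α₂ := 1 / 4) (δ₃ := δ₃) (α₃ := 1 / 4)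
    (by positivity) (by positivity) (by positivity) hδ₃.le (by norm_num)
  obtain ⟨MLC, hgeoC⟩ := geo_inputs3_geo9K (fun _ : KIdx θ.d₆ θ.ℓ₆ θ.hd' θ.hL' θ.b₀ θ.b₁ => (0 : ℝ)) (fun _ => True)
    (δ₁ := δc) (α₁ := 1 / 4) (δ₂ := (1 - 1 / 4) * ρ) (α₂ := 1 / 4) (δ₃ := (1 - 1 / 4) * ((1 - 1 / 4) * ρ)) (α₃ := 1 / 4)
    (by positivity) (by positivity) (by positivity) (by positivity) (by norm_num)
  -- the row constants: opaque atoms with defining equations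
  obtain ⟨cg, hcgdef⟩ : ∃ c : ℝ, c = B6.c1 (max (exp261 (geo9K (d := θ.d₆) (ℓ := θ.ℓ₆) (hd := θ.hd') (hL := θ.hL') (b₀ := θ.b₀) (b₁ := θ.b₁)) ((1 - 1 / 4) * δ) (1 / 4))
    (exp261 (geo9K (d := θ.d₆) (ℓ := θ.ℓ₆) (hd := θ.hd') (hL := θ.hL') (b₀ := θ.b₀) (b₁ := θ.b₁)) δ₀ (1 / 2))) δ₀ (1 / 2) := ⟨_, rfl⟩
  obtain ⟨cb, hcbdef⟩ : ∃ c : ℝ, c = B6.c1 (exp261 (geo9K (d := θ.d₆) (ℓ := θ.ℓ₆) (hd := θ.hd') (hL := θ.hL') (b₀ := θ.b₀) (b₁ := θ.b₁)) δc (1 / 4)) δc (1 / 4) :=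
    ⟨_, rfl⟩
  obtain ⟨c₁, hc₁def⟩ : ∃ c : ℝ, c = B6.c1 (max (exp261 (geo9K (d := θ.d₆) (ℓ := θ.ℓ₆) (hd := θ.hd') (hL := θ.hL') (b₀ := θ.b₀) (b₁ := θ.b₁)) ((1 - 1 / 4) * δ) (1 / 4))
    (exp261 (geo9K (d := θ.d₆) (ℓ := θ.ℓ₆) (hd := θ.hd') (hL := θ.hL') (b₀ := θ.b₀) (b₁ := θ.b₁)) δ₀ (1 / 2))) ((1 - 1 / 4) * δ) (1 / 4) := ⟨_, rfl⟩
  obtain ⟨c₂, hc₂def⟩ : ∃ c : ℝ, c = B6.c1 (exp261 (geo9K (d := θ.d₆) (ℓ := θ.ℓ₆) (hd := θ.hd') (hL := θ.hL') (b₀ := θ.b₀) (b₁ := θ.b₁)) ((1 - 1 / 4) * δ₁) (1 / 4))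
    ((1 - 1 / 4) * δ₁) (1 / 4) := ⟨_, rfl⟩
  obtain ⟨c₃, hc₃def⟩ : ∃ c : ℝ, c = B6.c1 (max (exp261 (geo9K (d := θ.d₆) (ℓ := θ.ℓ₆) (hd := θ.hd') (hL := θ.hL') (b₀ := θ.b₀) (b₁ := θ.b₁)) ((1 - 1 / 4) * δ₂) (1 / 4))
    (exp261 (geo9K (d := θ.d₆) (ℓ := θ.ℓ₆) (hd := θ.hd') (hL := θ.hL') (b₀ := θ.b₀) (b₁ := θ.b₁)) δ₃ (1 / 4))) ((1 - 1 / 4) * δ₂) (1 / 4) := ⟨_, rfl⟩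
  obtain ⟨c₄, hc₄def⟩ : ∃ c : ℝ, c = B6.c1 (max (exp261 (geo9K (d := θ.d₆) (ℓ := θ.ℓ₆) (hd := θ.hd') (hL := θ.hL') (b₀ := θ.b₀) (b₁ := θ.b₁)) ((1 - 1 / 4) * δ₂) (1 / 4))
    (exp261 (geo9K (d := θ.d₆) (ℓ := θ.ℓ₆) (hd := θ.hd') (hL := θ.hL') (b₀ := θ.b₀) (b₁ := θ.b₁)) δ₃ (1 / 4))) δ₃ (1 / 4) := ⟨_, rfl⟩
  obtain ⟨cE, hcEdef⟩ : ∃ c : ℝ, c = B6.c1 (max (exp261 (geo9K (d := θ.d₆) (ℓ := θ.ℓ₆) (hd := θ.hd') (hL := θ.hL') (b₀ := θ.b₀) (b₁ := θ.b₁)) ((1 - 1 / 4) * ρ) (1 / 4))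
    (exp261 (geo9K (d := θ.d₆) (ℓ := θ.ℓ₆) (hd := θ.hd') (hL := θ.hL') (b₀ := θ.b₀) (b₁ := θ.b₁)) ((1 - 1 / 4) * ((1 - 1 / 4) * ρ)) (1 / 4)))
    ((1 - 1 / 4) * ρ) (1 / 4) := ⟨_, rfl⟩
  obtain ⟨cE', hcE'def⟩ : ∃ c : ℝ, c = B6.c1 (max (exp261 (geo9K (d := θ.d₆) (ℓ := θ.ℓ₆) (hd := θ.hd') (hL := θ.hL') (b₀ := θ.b₀) (b₁ := θ.b₁)) ((1 - 1 / 4) * ρ) (1 / 4))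
    (exp261 (geo9K (d := θ.d₆) (ℓ := θ.ℓ₆) (hd := θ.hd') (hL := θ.hL') (b₀ := θ.b₀) (b₁ := θ.b₁)) ((1 - 1 / 4) * ((1 - 1 / 4) * ρ)) (1 / 4)))
    ((1 - 1 / 4) * ((1 - 1 / 4) * ρ)) (1 / 4) := ⟨_, rfl⟩
  have hcg0 : 0 ≤ cg := by rw [hcgdef]; exact c1_nonneg _ _ _
  have hcb0 : 0 ≤ cb := by rw [hcbdef]; exact c1_nonneg _ _ _
  have hc₁0 : 0 ≤ c₁ := by rw [hc₁def]; exact c1_nonneg _ _ _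
  have hc₂0 : 0 ≤ c₂ := by rw [hc₂def]; exact c1_nonneg _ _ _
  have hc₃0 : 0 ≤ c₃ := by rw [hc₃def]; exact c1_nonneg _ _ _
  have hc₄0 : 0 ≤ c₄ := by rw [hc₄def]; exact c1_nonneg _ _ _
  have hcE0 : 0 ≤ cE := by rw [hcEdef]; exact c1_nonneg _ _ _
  have hcE'0 : 0 ≤ cE' := by rw [hcE'def]; exact c1_nonneg _ _ _
  -- ═══ the starred atoms, the three windows and the fixed junction parameter `a₀K` (all opaque) ═══
  obtain ⟨AKs, hAKsdef⟩ : ∃ t : ℝ, t = 2 * A * cg := ⟨_, rfl⟩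
  obtain ⟨BXs, hBXsdef⟩ : ∃ t : ℝ, t = A * (1 + cg) := ⟨_, rfl⟩
  obtain ⟨Fs, hFsdef⟩ : ∃ t : ℝ, t = (2 * (8 * Dd) * κ) * κ * (A * A * L ^ 2 * c₁)
      + κ * κ * ((A + AKs) * (AKs * ((32 * Dd * κ) * A) * L ^ 2 * c₁) * L ^ 2 * c₂) + κ * (2 * (8 * Dd) * κ) * (AKs * AKs * L ^ 2 * c₁) := ⟨_, rfl⟩
  obtain ⟨B1s, hB1sdef⟩ : ∃ t : ℝ, t = max KT (2 * KT * c₄) := ⟨_, rfl⟩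
  obtain ⟨BY, hBYdef⟩ : ∃ t : ℝ, t = ((θ.d₆ : ℝ) + 1) * A := ⟨_, rfl⟩
  obtain ⟨Js, hJsdef⟩ : ∃ t : ℝ, t = (L ^ 4) ^ 4 * cb ^ 2 *
      (κ * κ * (BXs * (32 * Dd * κ) * A * L * cb) * B1s * BY + κ * (2 * (8 * Dd) * κ) * BXs * B1s * BY
        + κ * κ * BXs * (B1s * B1s * Fs * L ^ 4 * cb ^ 2) * BY + (2 * (8 * Dd) * κ) * κ * BXs * B1s * BY
        + κ * κ * BXs * B1s * (AKs * (32 * Dd * κ) * BY * L * cb)) := ⟨_, rfl⟩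
  have hAKs0 : 0 ≤ AKs := by rw [hAKsdef]; positivity
  have hBXs0 : 0 ≤ BXs := by rw [hBXsdef]; positivity
  have hFs0 : 0 ≤ Fs := by rw [hFsdef]; positivity
  have hB1s0 : 0 ≤ B1s := by rw [hB1sdef]; exact hKT.trans (le_max_left _ _)
  have hBY0 : 0 ≤ BY := by rw [hBYdef]; positivity
  have hJs0 : 0 ≤ Js := by rw [hJsdef]; positivity
  obtain ⟨w₁, hw₁def⟩ : ∃ t : ℝ, t = 1 / (2 * (32 * Dd * κ * A * cg) + 1) := ⟨_, rfl⟩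
  obtain ⟨w₂, hw₂def⟩ : ∃ t : ℝ, t = 1 / (2 * (Fs * KT * L ^ 4 * c₃ * c₄) + 1) := ⟨_, rfl⟩
  obtain ⟨w₃, hw₃def⟩ : ∃ t : ℝ, t = 1 / (Js * BG * L ^ 2 * cE * cE' + 1) := ⟨_, rfl⟩
  have hw₁0 : 0 < w₁ := by rw [hw₁def]; positivity
  have hw₂0 : 0 < w₂ := by rw [hw₂def]; positivity
  have hw₃0 : 0 < w₃ := by rw [hw₃def]; positivity
  obtain ⟨a₀K, ha₀Kdef⟩ : ∃ t : ℝ, t = min (alphaQ (θ.d₆ + 1) (θ.ℓ₆ + 1)) (min w₁ (min w₂ w₃)) := ⟨_, rfl⟩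
  have ha₀K : 0 < a₀K := by rw [ha₀Kdef]; exact lt_min (alphaQ_pos _ (Nat.le_add_left 1 θ.ℓ₆)) (lt_min hw₁0 (lt_min hw₂0 hw₃0))
  have haQ : a₀K ≤ alphaQ (θ.d₆ + 1) (θ.ℓ₆ + 1) := by rw [ha₀Kdef]; exact min_le_left _ _
  have haw₁ : a₀K ≤ 1 / (2 * (32 * Dd * κ * A * cg) + 1) := by rw [ha₀Kdef, ← hw₁def]; exact (min_le_right _ _).trans (min_le_left _ _)
  have haw₂ : a₀K ≤ 1 / (2 * (Fs * KT * L ^ 4 * c₃ * c₄) + 1) := by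
    rw [ha₀Kdef, ← hw₂def]; exact (min_le_right _ _).trans ((min_le_right _ _).trans (min_le_left _ _))
  have haw₃ : a₀K ≤ 1 / (Js * BG * L ^ 2 * cE * cE' + 1) := by
    rw [ha₀Kdef, ← hw₃def]; exact (min_le_right _ _).trans ((min_le_right _ _).trans (min_le_right _ _))
  have hα3 : B7Prop2Explicit.C0 (θ.d₆ + 1) * a₀K ≤ 1 / 3 :=
    (mul_le_mul_of_nonneg_left haQ (B7Prop2Explicit.C0_pos _).le).trans (C0_mul_alphaQ_le _ _)
  have hα2 : 2 * a₀K ≤ B7Prop2Explicit.c2' (θ.d₆ + 1) (θ.ℓ₆ + 1) := by linarith only [four_mul_alphaQ_le (θ.d₆ + 1) (θ.ℓ₆ + 1), haQ, ha₀K]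
  -- ═══ the junction's own constants at `α₀′ := a₀K` (opaque atoms with defining equations, in file 6's binder shapes) ═══
  obtain ⟨θE, hθEdef⟩ : ∃ t : ℝ, t = 32 * Dd * a₀K * κ := ⟨_, rfl⟩
  have hθE0 : 0 ≤ θE := by rw [hθEdef]; positivity
  have hW1 : θE * A * cg ≤ 1 / 2 := by
    have h := le_half_of_le_window (x := 32 * Dd * κ * A * cg) (by positivity) ha₀K.le haw₁
    calc θE * A * cg = a₀K * (32 * Dd * κ * A * cg) := by rw [hθEdef]; ring
      _ ≤ 1 / 2 := h
  have hWnn : 0 ≤ θE * A * cg := by positivity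
  obtain ⟨hsmallg, hAKle, hBXle⟩ := window_AK_BX (A₁ := A) hWnn hW1 hA0 hA0 hcg0
  obtain ⟨AK, hAKdef⟩ : ∃ t : ℝ, t = A * cg * (1 - θE * A * cg)⁻¹ := ⟨_, rfl⟩
  have hAK0 : 0 ≤ AK := by rw [hAKdef]; exact mul_nonneg (mul_nonneg hA0 hcg0) (inv_nonneg.2 (by linarith only [hsmallg]))
  have hAKs : AK ≤ AKs := by rw [hAKdef, hAKsdef]; exact hAKle
  obtain ⟨BX, hBXdef⟩ : ∃ t : ℝ, t = A * (1 + cg * (θE * A * cg * (1 - θE * A * cg)⁻¹)) := ⟨_, rfl⟩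
  have hBXs : BX ≤ BXs := by rw [hBXdef, hBXsdef]; exact hBXle
  have hBX0 : 0 ≤ BX := by
    rw [hBXdef]; exact mul_nonneg hA0 (add_nonneg zero_le_one (mul_nonneg hcg0 (mul_nonneg hWnn (inv_nonneg.2 (by linarith only [hsmallg])))))
  obtain ⟨θF, hθFdef⟩ : ∃ t : ℝ, t = (2 * (8 * Dd * a₀K) * κ) * κ * (A * A * L ^ 2 * c₁)
      + κ * κ * ((A + AK) * (AK * (θE * A) * L ^ 2 * c₁) * L ^ 2 * c₂) + κ * ((2 * (8 * Dd * a₀K)) * κ) * (AK * AK * L ^ 2 * c₁) := ⟨_, rfl⟩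
  have hθF0 : 0 ≤ θF := by rw [hθFdef]; positivity
  have hθFle : θF ≤ a₀K * Fs := by
    have h := thetaF_le (C := L ^ 2) (c₁ := c₁) (c₂ := c₂) (D := Dd) (κ := κ) (A := A) ha₀K.le hκ0 hA0 hAK0 hAKs (by positivity) hc₁0 hc₂0 hDd0
    rw [hθFdef, hFsdef, hθEdef]
    calc _ = (2 * (8 * Dd * a₀K) * κ) * κ * (A * A * L ^ 2 * c₁) + κ * κ * ((A + AK) * (AK * ((32 * Dd * a₀K * κ) * A) * L ^ 2 * c₁) * L ^ 2 * c₂)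
          + κ * (2 * (8 * Dd * a₀K) * κ) * (AK * AK * L ^ 2 * c₁) := by ring
      _ ≤ _ := h
      _ = _ := by ring
  have hW2 : θF * KT * L ^ 4 * c₃ * c₄ ≤ 1 / 2 := by
    have h2 : a₀K * (Fs * KT * L ^ 4 * c₃ * c₄) ≤ 1 / 2 := le_half_of_le_window (by positivity) ha₀K.le haw₂
    have h3 : θF * KT * L ^ 4 * c₃ * c₄ ≤ a₀K * Fs * KT * L ^ 4 * c₃ * c₄ :=
      mul_le_mul_of_nonneg_right (mul_le_mul_of_nonneg_right (mul_le_mul_of_nonneg_right (mul_le_mul_of_nonneg_right hθFle hKT) (by positivity)) hc₃0) hc₄0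
    calc θF * KT * L ^ 4 * c₃ * c₄ ≤ a₀K * Fs * KT * L ^ 4 * c₃ * c₄ := h3
      _ = a₀K * (Fs * KT * L ^ 4 * c₃ * c₄) := by ring
      _ ≤ 1 / 2 := h2
  obtain ⟨hsmall2, -, hB₁le⟩ := window_KK_B1 (K := KT) (c₄ := c₄) hW2 hKT hc₄0
  obtain ⟨KK, hKKdef⟩ : ∃ t : ℝ, t = KT * c₄ * (1 - θF * KT * L ^ 4 * c₃ * c₄)⁻¹ := ⟨_, rfl⟩
  obtain ⟨B₁, hB₁def⟩ : ∃ t : ℝ, t = max KT KK := ⟨_, rfl⟩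
  have hB₁s : B₁ ≤ B1s := by rw [hB₁def, hB1sdef, hKKdef]; exact hB₁le
  have hB₁0 : 0 ≤ B₁ := by rw [hB₁def]; exact hKT.trans (le_max_left _ _)
  obtain ⟨θQ, hθQdef⟩ : ∃ t : ℝ, t = 2 * (8 * Dd * a₀K) * κ := ⟨_, rfl⟩
  obtain ⟨θX, hθXdef⟩ : ∃ t : ℝ, t = BX * θE * A * L * cb := ⟨_, rfl⟩
  obtain ⟨θY, hθYdef⟩ : ∃ t : ℝ, t = AK * θE * BY * L * cb := ⟨_, rfl⟩
  obtain ⟨θC, hθCdef⟩ : ∃ t : ℝ, t = B₁ * B₁ * θF * L ^ 4 * cb ^ 2 := ⟨_, rfl⟩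
  obtain ⟨κJ, hκJdef⟩ : ∃ t : ℝ, t = (L ^ 4) ^ 4 * cb ^ 2 *
      (κ * κ * θX * B₁ * BY + κ * θQ * BX * B₁ * BY + κ * κ * BX * θC * BY + θQ * κ * BX * B₁ * BY + κ * κ * BX * B₁ * θY) := ⟨_, rfl⟩
  -- `κ_J ≤ a₀K·J⋆` (file 8a, pure ℝ, all atoms opaque)
  have hκJle : κJ ≤ a₀K * Js := by
    have h := kappaJ_le (a := a₀K) (κ := κ) (κQ := κ) (A := A) (BX := BX) (BXs := BXs) (B₁ := B₁) (B1s := B1s) (BY := BY) (AK := AK) (AKs := AKs)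
      (θF := θF) (Fs := Fs) (Λ := L) (Λ₄ := L ^ 4) (ΛB := L ^ 4) (cb := cb) (c₅ := cb) (cB := cb) (D := Dd)
      ha₀K.le hκ0 hκ0 hA0 hBX0 hBXs hB₁0 hB₁s hBY0 hAK0 hAKs hθF0 hθFle hL0.le (by positivity) hcb0 hDd0
    rw [hκJdef, hJsdef, hθXdef, hθYdef, hθCdef, hθQdef, hθEdef]
    calc _ = (L ^ 4) ^ 4 * cb ^ 2 *
          (κ * κ * (BX * (32 * Dd * a₀K * κ) * A * L * cb) * B₁ * BY + κ * (2 * (8 * Dd * a₀K) * κ) * BX * B₁ * BY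
            + κ * κ * BX * (B₁ * B₁ * θF * L ^ 4 * cb ^ 2) * BY + (2 * (8 * Dd * a₀K) * κ) * κ * BX * B₁ * BY
            + κ * κ * BX * B₁ * (AK * (32 * Dd * a₀K * κ) * BY * L * cb)) := by ring
      _ ≤ _ := h
      _ = _ := by ring
  -- window 3: the Neumann series at the `Δ_a` level
  have hW3 : a₀K * Js * BG * L ^ 2 * cE * cE' < 1 := by
    have h := lt_one_of_le_window (x := Js * BG * L ^ 2 * cE * cE') (by positivity) haw₃
    calc a₀K * Js * BG * L ^ 2 * cE * cE' = a₀K * (Js * BG * L ^ 2 * cE * cE') := by ring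
      _ < 1 := h
  -- ═══ the thresholds ═══
  have hD1 : 0 ≤ D1 thetaProf := D1_nonneg contDiff_thetaProf hasCompactSupport_thetaProf
  obtain ⟨amin, hamin⟩ : ∃ t : ℝ, t = min (min a₁G a₁T) (1 / 4) := ⟨_, rfl⟩
  have hamin0 : 0 < amin := by rw [hamin]; exact lt_min (lt_min ha₁G ha₁T) (by norm_num)
  have haminG : amin ≤ a₁G := by rw [hamin]; exact (min_le_left _ _).trans (min_le_left _ _)
  have haminT : amin ≤ a₁T := by rw [hamin]; exact (min_le_left _ _).trans (min_le_right _ _)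
  have hamin4 : amin ≤ 1 / 4 := by rw [hamin]; exact min_le_right _ _
  have he4 : 0 < Real.exp 4 := Real.exp_pos _
  obtain ⟨abud, habud⟩ : ∃ t : ℝ, t = min a₁A (min (amin / (2 * L ^ 6 * (1 + D1 thetaProf))) (min (1 / (10 * L)) (a₀K / (2 * (40 * Real.exp 4 * L ^ 5))))) :=
    ⟨_, rfl⟩
  have habud0 : 0 < abud := by
    rw [habud]
    exact lt_min ha₁A (lt_min (div_pos hamin0 (by positivity)) (lt_min (by positivity) (div_pos ha₀K (by positivity))))
  obtain ⟨Mtr, hMtr⟩ : ∃ t : ℝ, t = 16 * Real.log L / (1 / 4 * ρ * (2 * L ^ 2 - 1)) := ⟨_, rfl⟩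
  obtain ⟨M₁, hM₁def⟩ : ∃ t : ℝ, t = max (max M₁A 1) (max (max (max M₀G M₀T) (max ((N₀G : ℝ) + 1) ((N₀T : ℝ) + 1)))
    (max (max (T₀G + 1) (T₀T + 1)) (max (max MLA (max MLB MLC)) Mtr))) := ⟨_, rfl⟩
  -- output constants
  obtain ⟨δK, hδKdef⟩ : ∃ t : ℝ, t = (1 - 1 / 4) * ((1 - 1 / 4) * ((1 - 1 / 4) * ρ)) := ⟨_, rfl⟩
  obtain ⟨CK, hCKdef⟩ : ∃ t : ℝ, t = BG * cE' * (1 - a₀K * Js * BG * L ^ 2 * cE * cE')⁻¹ := ⟨_, rfl⟩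
  refine ⟨M₁, abud, δK, CK, by rw [hM₁def]; exact lt_of_lt_of_le one_pos ((le_max_right _ _).trans (le_max_left _ _)), habud0,
    by rw [hδKdef]; positivity, by rw [hCKdef]; exact mul_nonneg (mul_nonneg hBG0 hcE'0) (inv_nonneg.2 (sub_nonneg.2 hW3.le)), ?_⟩
  intro x hsurj hM α₀ hα ha U hU
  rw [hM₁def] at hM
  rw [habud] at ha
  -- ═══ the member's index facts ═══
  have hMeq : (geo9Y x).M = L * x.Mh := by rw [B9Ineq349SiteFromBlocks.geo9Y_M_eq]
  have hMK' : (kGeo x.toKIdx).M = (geo9Y x).M := rfl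
  have hMK9 : (geo9K x.toKIdx).M = (geo9Y x).M := rfl
  have hLK : (kGeo x.toKIdx).L = L := by rw [hLdef]; show (((θ.ℓ₆ + 1 : ℕ) : ℝ)) = _; push_cast; ring
  have hM₁A' : M₁A ≤ (geo9Y x).M := ((le_max_left _ _).trans (le_max_left _ _)).trans hM
  have hMmid : max (max M₀G M₀T) (max ((N₀G : ℝ) + 1) ((N₀T : ℝ) + 1)) ≤ (geo9Y x).M := ((le_max_left _ _).trans (le_max_right _ _)).trans hM
  have hMlast : max (max (T₀G + 1) (T₀T + 1)) (max (max MLA (max MLB MLC)) Mtr) ≤ (geo9Y x).M := ((le_max_right _ _).trans (le_max_right _ _)).trans hM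
  have hMpos : 0 ≤ (geo9Y x).M := geo9Y_M_nonneg θ Mstar x
  have hMh1 : 1 ≤ (θ.ℓ₆ + 1) * x.Mh := Nat.one_le_iff_ne_zero.2 (Nat.mul_ne_zero (Nat.succ_ne_zero _) (by have := x.hM8; omega))
  have hR1 : 1 ≤ x.R := le_trans (by have := θ.one_le_ℓ₆; nlinarith) x.hR2
  have idxM : ∀ {M₀ : ℝ}, M₀ ≤ (geo9Y x).M → M₀ ≤ ((θ.ℓ₆ : ℝ) + 1) * (toKT x.toKIdx).Mh := fun h => by rw [hMeq] at h; exact h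
  have idxN : ∀ {N₀ : ℕ}, ((N₀ : ℝ) + 1) ≤ (geo9Y x).M → N₀ + 1 ≤ (toKT x.toKIdx).R * ((θ.ℓ₆ + 1) * (toKT x.toKIdx).Mh) := by
    intro N₀ h
    show N₀ + 1 ≤ x.R * ((θ.ℓ₆ + 1) * x.Mh)
    have h1 : ((N₀ : ℝ) + 1) ≤ L * x.Mh := by rw [← hMeq]; exact h
    have h2 : N₀ + 1 ≤ (θ.ℓ₆ + 1) * x.Mh := by rw [hLdef] at h1; exact_mod_cast h1
    exact h2.trans (Nat.le_mul_of_pos_left _ hR1)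
  have idxT : ∀ {T₀ : ℝ}, T₀ + 1 ≤ (geo9Y x).M → T₀ ≤ B9CubeGeometryInputs.RM1 x.toKIdx := by
    intro T₀ h
    unfold B9CubeGeometryInputs.RM1
    show T₀ ≤ (((x.R * ((θ.ℓ₆ + 1) * x.Mh) - 1 : ℕ)) : ℝ)
    have h1 : T₀ + 1 ≤ L * x.Mh := by rw [← hMeq]; exact h
    have h3 : (θ.ℓ₆ + 1) * x.Mh ≤ x.R * ((θ.ℓ₆ + 1) * x.Mh) := Nat.le_mul_of_pos_left _ hR1
    have h4 : (((θ.ℓ₆ + 1) * x.Mh : ℕ) : ℝ) ≤ ((x.R * ((θ.ℓ₆ + 1) * x.Mh) : ℕ) : ℝ) := by exact_mod_cast h3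
    rw [Nat.cast_sub (hMh1.trans h3)]
    push_cast at h4 ⊢
    rw [hLdef] at h1
    linarith only [h1, h4]
  have hM0G := idxM ((le_max_left _ _).trans ((le_max_left _ _).trans hMmid))
  have hM0T := idxM ((le_max_right _ _).trans ((le_max_left _ _).trans hMmid))
  have hN0G := idxN ((le_max_left _ _).trans ((le_max_right _ _).trans hMmid))
  have hN0T := idxN ((le_max_right _ _).trans ((le_max_right _ _).trans hMmid))
  have hT0G := idxT ((le_max_left _ _).trans ((le_max_left _ _).trans hMlast))
  have hT0T := idxT ((le_max_right _ _).trans ((le_max_left _ _).trans hMlast))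
  have hMLA : MLA ≤ (geo9K x.toKIdx).M := ((le_max_left _ _).trans ((le_max_left _ _).trans ((le_max_right _ _).trans hMlast)))
  have hMLB : MLB ≤ (geo9K x.toKIdx).M :=
    ((le_max_left _ _).trans ((le_max_right _ _).trans ((le_max_left _ _).trans ((le_max_right _ _).trans hMlast))))
  have hMLC : MLC ≤ (geo9K x.toKIdx).M :=
    ((le_max_right _ _).trans ((le_max_right _ _).trans ((le_max_left _ _).trans ((le_max_right _ _).trans hMlast))))
  have hMtr' : Mtr ≤ (geo9Y x).M := (le_max_right _ _).trans ((le_max_right _ _).trans hMlast)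
  -- ═══ the guard `M·α₀ ≤ a₁` unfolded ═══
  have hMα : 0 ≤ (geo9Y x).M * α₀ := mul_nonneg hMpos hα.le
  have haA : (geo9Y x).M * α₀ ≤ a₁A := ha.trans (min_le_left _ _)
  have ha1 : (geo9Y x).M * α₀ ≤ amin / (2 * L ^ 6 * (1 + D1 thetaProf)) := ha.trans ((min_le_right _ _).trans (min_le_left _ _))
  have ha3 : (geo9Y x).M * α₀ ≤ 1 / (10 * L) := ha.trans ((min_le_right _ _).trans ((min_le_right _ _).trans (min_le_left _ _)))
  have ha4 : (geo9Y x).M * α₀ ≤ a₀K / (2 * (40 * Real.exp 4 * L ^ 5)) :=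
    ha.trans ((min_le_right _ _).trans ((min_le_right _ _).trans (min_le_right _ _)))
  have hK1 : 10 * (kGeo x.toKIdx).L * ((kGeo x.toKIdx).M * α₀) ≤ 1 := by
    rw [hLK, hMK']
    have := (le_div_iff₀ (by positivity : (0:ℝ) < 10 * L)).1 ha3
    linarith only [this]
  have hKnum : Kpl x.toKIdx ((kGeo x.toKIdx).M * α₀) * (kGeo x.toKIdx).L ^ 4 < a₀K := by
    refine Kpl_lt_of_le x.toKIdx (by rw [hMK']; exact hMα) hK1 ?_
    rw [hLK, hMK']
    have hpos : (0:ℝ) < 2 * (40 * Real.exp 4 * L ^ 5) := by positivity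
    have h1 := (le_div_iff₀ hpos).1 ha4
    linarith only [h1, ha₀K]
  -- ═══ the class: `U` is `SU(N)`-valued; the cube datum on the balls `NearC_□(35S_j∕8 + 1)` ═══
  have hUG : ∀ μ z, U μ z ∈ specialUnitaryUnits (Fin N) := hU.1.1
  obtain ⟨hη, hLK1, hMK⟩ := eta_pos_L_one_le_M_pos x.toKIdx
  have hdat : ∀ c : ↥(cubes (toKT x.toKIdx).D.toDomains),
      Reg335Cube (shiftsV1 (PV θ.d₆ θ.ℓ₆ x.m x.K θ.hd' θ.hL')) U (kGeo x.toKIdx).eta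
        {w | NearC x.toKIdx c (35 * SC x.toKIdx c / 8 + 1) (boxEquiv x.hN w).1}
        (scaleLen (kGeo x.toKIdx).L (kGeo x.toKIdx).eta c.1.1) (2 * (kGeo x.toKIdx).L ^ 4 * ((kGeo x.toKIdx).M * α₀)) :=
    fun c => reg335Cube_nearC_of_reg335P x.toKIdx c (by norm_num [c35Y]) hα.le hU.1
  obtain ⟨g, Afld, hu, hgA, hA, hdA⟩ := exists_cubeData_of_reg335Cubes x.toKIdx U _ _ _ hdat
  have hC0 : 0 ≤ 2 * (kGeo x.toKIdx).L ^ 4 * ((kGeo x.toKIdx).M * α₀) := by rw [hMK']; positivity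
  have hξ0 : ∀ c : ↥(cubes (toKT x.toKIdx).D.toDomains), 0 < scaleLen (kGeo x.toKIdx).L (kGeo x.toKIdx).eta c.1.1 :=
    fun c => LatticeNorms.scaleLen_pos (lt_of_lt_of_le one_pos hLK1) hη _
  have hξ5 : ∀ c : ↥(cubes (toKT x.toKIdx).D.toDomains),
      scaleLen (kGeo x.toKIdx).L (kGeo x.toKIdx).eta c.1.1 ≤ 5 * (SC x.toKIdx c : ℝ) * (kGeo x.toKIdx).eta := by
    intro c
    unfold LatticeNorms.scaleLen
    have hS : (kGeo x.toKIdx).L ^ c.1.1 ≤ (SC x.toKIdx c : ℝ) := by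
      rw [hLK, hLdef]
      show ((θ.ℓ₆ : ℝ) + 1) ^ c.1.1 ≤ ((B9CubeSequence408.sI θ.ℓ₆ (toKT x.toKIdx).Mh c.1.1 : ℤ) : ℝ)
      unfold B9CubeSequence408.sI B6MultiLevelBoxOperator.bigSide
      have h8 : 8 ≤ x.Mh := x.hM8
      have h1 : (θ.ℓ₆ + 1) ^ c.1.1 ≤ x.Mh * (θ.ℓ₆ + 1) ^ (c.1.1 + 1) :=
        le_trans (Nat.pow_le_pow_right (Nat.succ_pos _) (Nat.le_succ _)) (Nat.le_mul_of_pos_left _ (by omega))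
      have h2 : (((θ.ℓ₆ + 1) ^ c.1.1 : ℕ) : ℝ) ≤ ((x.Mh * (θ.ℓ₆ + 1) ^ (c.1.1 + 1) : ℕ) : ℝ) := by exact_mod_cast h1
      push_cast at h2 ⊢
      exact h2
    have hSC0 : 0 ≤ (SC x.toKIdx c : ℝ) := le_trans (pow_pos (lt_of_lt_of_le one_pos hLK1) _).le hS
    have hSe : 0 ≤ (SC x.toKIdx c : ℝ) * (kGeo x.toKIdx).eta := mul_nonneg hSC0 hη.le
    calc (kGeo x.toKIdx).L ^ c.1.1 * (kGeo x.toKIdx).eta ≤ (SC x.toKIdx c : ℝ) * (kGeo x.toKIdx).eta :=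
          mul_le_mul_of_nonneg_right hS hη.le
      _ ≤ 5 * (SC x.toKIdx c : ℝ) * (kGeo x.toKIdx).eta := by linarith only [hSe]
  have hscale : ∀ c : ↥(cubes (toKT x.toKIdx).D.toDomains),
      scaleLen ((θ.ℓ₆ : ℝ) + 1) (kGeo x.toKIdx).eta (c.1.1 + 1) ≤ (kGeo x.toKIdx).L * scaleLen (kGeo x.toKIdx).L (kGeo x.toKIdx).eta c.1.1 := by
    intro c; rw [hLK, hLdef, B9Eq335ClassBridgePV1.scaleLen_succ']
  have hsmallC : 2 * L ^ 6 * (1 + D1 thetaProf) * ((geo9Y x).M * α₀) ≤ amin := by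
    have hpos : 0 < 2 * L ^ 6 * (1 + D1 thetaProf) := by positivity
    calc 2 * L ^ 6 * (1 + D1 thetaProf) * ((geo9Y x).M * α₀)
        ≤ 2 * L ^ 6 * (1 + D1 thetaProf) * (amin / (2 * L ^ 6 * (1 + D1 thetaProf))) := mul_le_mul_of_nonneg_left ha1 hpos.le
      _ = amin := mul_div_cancel₀ _ hpos.ne'
  have hmaxeq : max (2 * (kGeo x.toKIdx).L ^ 4 * ((kGeo x.toKIdx).M * α₀)) (2 * (kGeo x.toKIdx).L ^ 4 * ((kGeo x.toKIdx).M * α₀) * (1 + D1 thetaProf))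
      * (kGeo x.toKIdx).L ^ 2 = 2 * L ^ 6 * (1 + D1 thetaProf) * ((geo9Y x).M * α₀) := by
    rw [max_eq_right (le_mul_of_one_le_right hC0 (by linarith only [hD1])), hLK, hMK']; ring
  have hbudG : ∀ _c : ↥(cubes (toKT x.toKIdx).D.toDomains),
      max (2 * (kGeo x.toKIdx).L ^ 4 * ((kGeo x.toKIdx).M * α₀)) (2 * (kGeo x.toKIdx).L ^ 4 * ((kGeo x.toKIdx).M * α₀) * (1 + D1 thetaProf))
        * (kGeo x.toKIdx).L ^ 2 ≤ a₁G := fun _ => by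
    rw [hmaxeq]; exact hsmallC.trans haminG
  have hbudT : ∀ _c : ↥(cubes (toKT x.toKIdx).D.toDomains),
      max (2 * (kGeo x.toKIdx).L ^ 4 * ((kGeo x.toKIdx).M * α₀)) (2 * (kGeo x.toKIdx).L ^ 4 * ((kGeo x.toKIdx).M * α₀) * (1 + D1 thetaProf))
        * (kGeo x.toKIdx).L ^ 2 ≤ a₁T := fun _ => by
    rw [hmaxeq]; exact hsmallC.trans haminT
  have hbud4 : ∀ _c : ↥(cubes (toKT x.toKIdx).D.toDomains),
      max (2 * (kGeo x.toKIdx).L ^ 4 * ((kGeo x.toKIdx).M * α₀)) (2 * (kGeo x.toKIdx).L ^ 4 * ((kGeo x.toKIdx).M * α₀) * (1 + D1 thetaProf))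
        * (kGeo x.toKIdx).L ^ 2 ≤ 1 / 4 := fun _ => by
    rw [hmaxeq]; exact hsmallC.trans hamin4
  -- ═══ the geometry at the member ═══
  obtain ⟨htri, hrefl, -, hdnn, h261b, h261d, h261g, h263g⟩ := hgeoA x.toKIdx hMLA
  obtain ⟨-, -, -, -, h261d₁, h261d₂, h261d₃, h263d₃⟩ := hgeoB x.toKIdx hMLB
  obtain ⟨-, -, -, -, h261c₅, h261E, h261E', h263E'⟩ := hgeoC x.toKIdx hMLC
  -- the transfers (one threshold `Mtr` serves all: rates `≥ ρ`, powers `≤ 4`)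
  have hthr : 16 * Real.log L ≤ 1 / 4 * ρ * (2 * L ^ 2 - 1) * (geo9K x.toKIdx).M := by
    have hpos : 0 < 1 / 4 * ρ * (2 * L ^ 2 - 1) := mul_pos (mul_pos (by norm_num) hρ) hPL'
    rw [hMtr] at hMtr'
    have := (div_le_iff₀ hpos).1 hMtr'
    rw [hMK9]; linarith only [this]
  have hMge : 0 ≤ (geo9K x.toKIdx).M := by rw [hMK9]; exact hMpos
  have hρδc : ρ ≤ δc := by rw [hρdef]; linarith only [hδc]
  have hρδ₂ : ρ ≤ δ₂ := by rw [hρdef, hδcdef, hδ₃def]; linarith only [hδ₂]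
  have hρδ₁ : ρ ≤ δ₁ := by rw [hδ₂def] at hρδ₂; linarith only [hρδ₂, hδ₁]
  have hρδ' : ρ ≤ δ := by rw [hδ₁def] at hρδ₁; linarith only [hρδ₁, hδ]
  have hT1ib : ScaleTransfer (geo9K x.toKIdx) δc (1 / 4) L (fun a => ((geo9K x.toKIdx).len a)⁻¹) := by
    have h := scaleTransfer_len_inv_pow_geo9K x.toKIdx 1 (δ := δc) (α := 1 / 4) (by positivity)
      (by rw [Nat.cast_one]; exact log_le_rate_mul hlogL hPL hMge hρδc (by norm_num) hthr)
    rw [pow_one, ← hLdef] at h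
    exact scaleTransfer_congr (fun y => by rw [pow_one]) h
  have hST : ScaleTransfer (geo9K x.toKIdx) δ (1 / 4) (L ^ 2) (fun a => (geo9K x.toKIdx).len a ^ 2) := by
    have h := scaleTransfer_len_sq_geo9K x.toKIdx (δ := δ) (α := 1 / 4) (by positivity)
      (log_le_rate_mul hlogL hPL hMge hρδ' (by norm_num) hthr)
    rw [← hLdef] at h; exact h
  have hST₂ : ScaleTransfer (geo9K x.toKIdx) δ₁ (1 / 4) (L ^ 2) (fun a => (geo9K x.toKIdx).len a ^ 2) := by
    have h := scaleTransfer_len_sq_geo9K x.toKIdx (δ := δ₁) (α := 1 / 4) (by positivity)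
      (log_le_rate_mul hlogL hPL hMge hρδ₁ (by norm_num) hthr)
    rw [← hLdef] at h; exact h
  have hST₃ : ScaleTransfer (geo9K x.toKIdx) δ₂ (1 / 4) (L ^ 4) (fun a => ((geo9K x.toKIdx).len a ^ 4)⁻¹) := by
    have h := scaleTransfer_len_inv_pow_geo9K x.toKIdx 4 (δ := δ₂) (α := 1 / 4) (by positivity)
      (by exact log_le_rate_mul hlogL hPL hMge hρδ₂ (by norm_num) hthr)
    rw [← hLdef] at h; exact h
  have hT4c : ScaleTransfer (geo9K x.toKIdx) δc (1 / 4) (L ^ 4) (fun a => ((geo9K x.toKIdx).len a ^ 4)⁻¹) := by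
    have h := scaleTransfer_len_inv_pow_geo9K x.toKIdx 4 (δ := δc) (α := 1 / 4) (by positivity)
      (by exact log_le_rate_mul hlogL hPL hMge hρδc (by norm_num) hthr)
    rw [← hLdef] at h; exact h
  have hT1B : ScaleTransfer (geo9K x.toKIdx) δc (1 / 4) (L ^ 4) (fun a => (geo9K x.toKIdx).len a) := by
    have h := scaleTransfer_len_geo9K x.toKIdx (δ := δc) (α := 1 / 4) (by positivity)
      (by have := log_le_rate_mul hlogL hPL hMge hρδc (by norm_num : (1:ℝ) ≤ 4) hthr; linarith only [this])
    rw [← hLdef] at h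
    have hL4 : L ≤ L ^ 4 := by
      calc L = L ^ 1 := (pow_one L).symm
        _ ≤ L ^ 4 := pow_le_pow_right₀ hL1 (by norm_num)
    exact scaleTransfer_mono_const (fun y => (geo9K_len_pos x.toKIdx y).le) hL4 h
  have hSTE : ScaleTransfer (geo9K x.toKIdx) ρ (1 / 4) (L ^ 2) (fun a => (geo9K x.toKIdx).len a ^ 2) := by
    have h := scaleTransfer_len_sq_geo9K x.toKIdx (δ := ρ) (α := 1 / 4) (by positivity)
      (log_le_rate_mul hlogL hPL hMge le_rfl (by norm_num) hthr)
    rw [← hLdef] at h; exact h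
  -- ═══ Thm 3.3's block at def-Y's letter ═══
  obtain ⟨hunitS, hES⟩ := HA x hsurj hM₁A' α₀ hα haA U hU
  -- ═══ the junction's defining equations in file 6's literal shapes (atoms unfolded to `B6.c1 …` once, by `rw`) ═══
  have hθE' : θE = 32 * ((θ.d₆ : ℝ) + 1) ^ 2 * a₀K * (M₂ * ∑ j, ‖basis39 (Matrix (Fin N) (Fin N) ℂ) j‖) := by
    rw [hθEdef]
  have hAK' := hAKdef
  rw [hcgdef] at hAK'
  have hsmallg' : θE * A * B6.c1 (max (exp261 (geo9K (d := θ.d₆) (ℓ := θ.ℓ₆) (hd := θ.hd') (hL := θ.hL') (b₀ := θ.b₀) (b₁ := θ.b₁)) ((1 - 1 / 4) * δ) (1 / 4))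
      (exp261 (geo9K (d := θ.d₆) (ℓ := θ.ℓ₆) (hd := θ.hd') (hL := θ.hL') (b₀ := θ.b₀) (b₁ := θ.b₁)) δ₀ (1 / 2))) δ₀ (1 / 2) < 1 := by
    rw [← hcgdef]; exact hsmallg
  have hθF' := hθFdef
  rw [hc₁def, hc₂def] at hθF'
  have hsmall2' := hsmall2
  rw [hc₃def, hc₄def] at hsmall2'
  have hKK' := hKKdef
  rw [hc₃def, hc₄def] at hKK'
  have hBX' := hBXdef
  rw [hcgdef] at hBX'
  have hθX' := hθXdef
  rw [hcbdef] at hθX'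
  have hθY' := hθYdef
  rw [hcbdef] at hθY'
  have hθC' := hθCdef
  rw [hcbdef] at hθC'
  have hκJ' := hκJdef
  rw [hcbdef] at hκJ'
  have hW3' := hW3
  rw [hcEdef, hcE'def] at hW3'
  -- ═══ per section ═══
  have main : ∀ (ιB : BlkY x.toKIdx → IBondY x.toKIdx), (∀ s, β x.hN x.D x.hk (ιB s) = s) →
      IsUnit (deltaAY x.toKIdx (B9B8AveragingJunction.parKnitY x.toKIdx) (parBY x.toKIdx) (GpY x.toKIdx (B9B8AveragingJunction.parKnitY x.toKIdx)) U) ∧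
      HasMajorant (g := toB6 (geo9K x.toKIdx) 0 True) (fun p : FBondY x.toKIdx × κ39 (Matrix (Fin N) (Fin N) ℂ) => ιB (blkV1 x.hN x.D p.1))
        (conj (basis39 (Matrix (Fin N) (Fin N) ℂ))
          ((GAY x.toKIdx (B9B8AveragingJunction.parKnitY x.toKIdx) (parBY x.toKIdx) (GpY x.toKIdx (B9B8AveragingJunction.parKnitY x.toKIdx)) U).restrictScalars ℝ))
        (fun a a' => CK * (geo9K x.toKIdx).len a ^ 2 * Real.exp (-(δK * (geo9K x.toKIdx).dist a a'))) := by
    intro ιB hι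
    -- the (3.42)₁ majorant of `G(U; parSymY)` from the block
    have hGS := hasMajorant_conj_G_of_eBlockInvB x.toKIdx (basis39 (Matrix (Fin N) (Fin N) ℂ)) (Rr := 0) (Hp := True)
      (B := bg9YP (Matrix (Fin N) (Fin N) ℂ) (specialUnitaryUnits (Fin N)) x) (U₁ := U) (fun V => V)
      (GAY x.toKIdx (parSymY x.toKIdx) (parBY x.toKIdx) (GpY x.toKIdx (parSymY x.toKIdx))) (parBY x.toKIdx)
      (hES (B := bg9YP (Matrix (Fin N) (Fin N) ℂ) (specialUnitaryUnits (Fin N)) x) (fun V => V) (parBY x.toKIdx) U rfl)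
      hKA ιB hι hM₂ hrepr ((GAY x.toKIdx (parSymY x.toKIdx) (parBY x.toKIdx) (GpY x.toKIdx (parSymY x.toKIdx)) U).restrictScalars ℝ)
      (fun Λ => LinearMap.restrictScalars_apply ℝ _ Λ)
    -- Thm 3.1 for `G′(U; parSymY)` from the cube datum, read as the three `parSymY`-side entries; Thm 3.2 for `X(U; parSymY)⁻¹`
    have hEG := (HG x.toKIdx hM0G hN0G hT0G x.hcfk ιB hι U hUG g hu Afld _ _ _ _ (fun _ => hC0) hξ0 (fun _ => hLK1) hξ5 hscale (fun c w hw => hw)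
      hgA hA hdA hbudG hbud4 (B := bg9YP (Matrix (Fin N) (Fin N) ℂ) (specialUnitaryUnits (Fin N)) x) (fun V => V) U rfl).1
    obtain ⟨hGs, hDl, hDr⟩ := symData_of_eBlockS x.toKIdx x.hcfk (Rg := 0) (Hg := True) (basis39 (Matrix (Fin N) (Fin N) ℂ)) hM₂ hrepr hKG
      (B := bg9YP (Matrix (Fin N) (Fin N) ℂ) (specialUnitaryUnits (Fin N)) x) (fun V => V) U U rfl hEG ιB hι
    have hT₀ := HT x.toKIdx hM0T hN0T hT0T x.hcfk ιB hι U hUG g hu Afld _ _ _ _ (fun _ => hC0) hξ0 (fun _ => hLK1) hξ5 hscale (fun c w hw => hw)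
      hgA hA hdA hbudT hbud4 (B := bg9YP (Matrix (Fin N) (Fin N) ℂ) (specialUnitaryUnits (Fin N)) x) (fun V => V) U rfl
    -- weaken all four to the base rate `δ₀`
    have hl2 : ∀ a : (geo9K x.toKIdx).Site, 0 ≤ (geo9K x.toKIdx).len a ^ 2 := fun a => sq_nonneg _
    have hl1 : ∀ a : (geo9K x.toKIdx).Site, 0 ≤ (geo9K x.toKIdx).len a := fun a => (geo9K_len_pos x.toKIdx a).le
    have hl4 : ∀ a : (geo9K x.toKIdx).Site, 0 ≤ ((geo9K x.toKIdx).len a ^ 4)⁻¹ := fun a => inv_nonneg.2 (pow_nonneg (hl1 a) 4)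
    have hl4' : ∀ a : (geo9K x.toKIdx).Site, 0 ≤ ((geo9K x.toKIdx).len a ^ 2)⁻¹ := fun a => inv_nonneg.2 (hl2 a)
    have hGs' := hasMajorant_rate_mono x.toKIdx (Rr := 0) (Hp := True) _ (fun a => (geo9K x.toKIdx).len a ^ 2) hA0 hl2 hδ₀G hGs
    have hDl' := fun μ => hasMajorant_rate_mono x.toKIdx (Rr := 0) (Hp := True) _ (fun a => (geo9K x.toKIdx).len a) hA0 hl1 hδ₀G (hDl μ)
    have hDr' := fun ν => hasMajorant_rate_mono x.toKIdx (Rr := 0) (Hp := True) _ (fun a => (geo9K x.toKIdx).len a) hA0 hl1 hδ₀G (hDr ν)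
    have hT₀' := hasMajorant_rate_mono x.toKIdx (Rr := 0) (Hp := True) _ (fun a => ((geo9K x.toKIdx).len a ^ 4)⁻¹) hKT hl4 hδ₀T hT₀
    -- ═══ the junction on (3.35) at `α₀′ := a₀K` (file 6), every constant passed as an atom ═══
    have hJ := hasMajorant_conj_DPDsY_sub_pars_reg335 x.toKIdx (basis39 (Matrix (Fin N) (Fin N) ℂ)) ιB (Rr := 0) (Hp := True)
      hG1 hGU (by norm_num [c35Y]) (by rw [hMK']; exact hMα) hU.1 ha₀K hα3 hα2 hKnum hι x.hcfk hM₂ hrepr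
      (hA := hA0) (hA₁ := hA0) (hA₂ := hA0) (hK0 := hKT) hGs' hDl' hDr' hT₀' htri hrefl
      _ (hαδg := by positivity) (hαδg' := by positivity) h261g h263g
      (hθE := hθE') (hAK := hAK') hsmallg'
      _ (δc := δc) (δb := δc) (αb := 1 / 4) (βb := 1 / 4) (Λ := L) hL1 hδc.le (by norm_num) (by norm_num) hδc.le
      (by rw [hδcdef, hδ₃def, hδ₂def, hδ₁def, hδdef]; linarith only [hδ₀]) h261b hT1ib
      _ _ _ _ (δ := δ) (δ₁ := δ₁) (δ₂ := δ₂) (δ₃ := δ₃) (αst := 1 / 4) (α' := 1 / 4) (α := 1 / 4) (C := L ^ 2) (C₄ := L ^ 4)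
      (by rw [hδdef]; linarith only [hδ₀]) rfl rfl rfl (by positivity) (one_le_pow₀ hL1) (by positivity) (by positivity) (by norm_num) (by norm_num)
      (by positivity) (by positivity) (by positivity) (by positivity) (by positivity) (by norm_num) (by positivity)
      hST h261d hST₂ h261d₁ hST₃ h261d₂ h261d₃ h263d₃ (hθF := hθF') hsmall2' (hKK := hKK')
      _ (δ₅ := δc) (α₅ := 1 / 4) (β₅ := 1 / 4) (Λ₄ := L ^ 4) (one_le_pow₀ hL1) (by norm_num) (by norm_num) hδc.le
      (by rw [hδcdef]; linarith only [hδ₃]) h261c₅ hT4c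
      _ (δB := δc) (αB := 1 / 4) (βB := 1 / 4) (ρ := ρ) (ΛB := L ^ 4) (one_le_pow₀ hL1) hρ.le (by norm_num) (by norm_num) hδc.le
      (by rw [hρdef]; linarith only [hδc]) h261b hT1B hT4c
      (hκQ := hκdef) (θQ := θQ) (hθQ := by rw [hθQdef]) (hBX := hBX') (hθX := hθX') (hBY := hBYdef) (hθY := hθY') (hB₁ := hB₁def) (hθC := hθC') (hκJ := hκJ')
    -- the `parSymY`-side majorant of `G` at the rate `ρ`, the difference at the rate `ρ`, the transfer (file 7)
    have hρδA : ρ ≤ δA := by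
      have : ρ ≤ δ₀ := by rw [hρdef, hδc_eq]; linarith only [hδ₀]
      exact this.trans hδ₀A
    have hGρ := hasMajorant_rate_mono x.toKIdx (Rr := 0) (Hp := True) _ (fun a => (geo9K x.toKIdx).len a ^ 2) hBG0 hl2 hρδA hGS
    have hΔeq := deltaAY_sub_deltaAY_eq_DPDsY_sub x.toKIdx (parSymY x.toKIdx) (B9B8AveragingJunction.parKnitY x.toKIdx) (parBY x.toKIdx)
      (GpY x.toKIdx (parSymY x.toKIdx)) (GpY x.toKIdx (B9B8AveragingJunction.parKnitY x.toKIdx)) U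
    have hE : HasMajorant (g := toB6 (geo9K x.toKIdx) 0 True) (fun p : FBondY x.toKIdx × κ39 (Matrix (Fin N) (Fin N) ℂ) => ιB (blkV1 x.hN x.D p.1))
        (conj (basis39 (Matrix (Fin N) (Fin N) ℂ)) ((deltaAY x.toKIdx (parSymY x.toKIdx) (parBY x.toKIdx) (GpY x.toKIdx (parSymY x.toKIdx)) U
          - deltaAY x.toKIdx (B9B8AveragingJunction.parKnitY x.toKIdx) (parBY x.toKIdx) (GpY x.toKIdx (B9B8AveragingJunction.parKnitY x.toKIdx)) U).restrictScalars ℝ))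
        (fun a a' => a₀K * Js * ((geo9K x.toKIdx).len a ^ 2)⁻¹ * Real.exp (-(ρ * (geo9K x.toKIdx).dist a a'))) := by
      -- `Δ_a(S) − Δ_a(K) = −(D_UP_SD*_U − D_UP_KD*_U)`: a majorant is blind to the sign
      have hneg : (deltaAY x.toKIdx (parSymY x.toKIdx) (parBY x.toKIdx) (GpY x.toKIdx (parSymY x.toKIdx)) U
            - deltaAY x.toKIdx (B9B8AveragingJunction.parKnitY x.toKIdx) (parBY x.toKIdx) (GpY x.toKIdx (B9B8AveragingJunction.parKnitY x.toKIdx)) U).restrictScalars ℝ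
          = -((DPDsY x.toKIdx (parSymY x.toKIdx) (GpY x.toKIdx (parSymY x.toKIdx)) U
              - DPDsY x.toKIdx (B9B8AveragingJunction.parKnitY x.toKIdx) (GpY x.toKIdx (B9B8AveragingJunction.parKnitY x.toKIdx)) U).restrictScalars ℝ) := by
        rw [hΔeq, ← LinearMap.restrictScalars_neg, neg_sub]
      rw [hneg, conj_neg]
      exact hasMajorant_neg _ (hasMajorant_mono _ hJ fun a a' => mul_le_mul_of_nonneg_right (mul_le_mul_of_nonneg_right hκJle (hl4' a)) (Real.exp_nonneg _))
    have h := isUnit_and_hasMajorant_GAY_of_majorants x.toKIdx (basis39 (Matrix (Fin N) (Fin N) ℂ)) ιB (Rr := 0) (Hp := True)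
      (B9B8AveragingJunction.parKnitY x.toKIdx) (parSymY x.toKIdx) (parBY x.toKIdx) (GpY x.toKIdx (B9B8AveragingJunction.parKnitY x.toKIdx))
      (GpY x.toKIdx (parSymY x.toKIdx)) U hunitS _ _ (δ := ρ) (αst := 1 / 4) (α' := 1 / 4) (α := 1 / 4) (Λ := L ^ 2) (κ := a₀K * Js) (B := BG)
      (by positivity) hBG0 (by positivity) (by positivity) (by norm_num) (by norm_num) (by positivity) (by positivity) htri hrefl hSTE h261E h261E' h263E'
      hW3' hGρ hE
    refine ⟨h.1, hasMajorant_mono _ h.2 fun a a' => le_of_eq ?_⟩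
    rw [hCKdef, hδKdef, hcEdef, hcE'def]
    try ring
  obtain ⟨ιB₀, hι₀⟩ : ∃ ιB : BlkY x.toKIdx → IBondY x.toKIdx, ∀ s, β x.hN x.D x.hk (ιB s) = s :=
    ⟨fun s => (hsurj s).choose, fun s => (hsurj s).choose_spec⟩
  exact ⟨(main ιB₀ hι₀).1, fun ιB hι => (main ιB hι).2⟩

end Record


end Literature.MathematicalPhysics.QuantumFieldTheory.Balaban1983to89.B9Thm33DeltaAAtKnitLetterOfRegYP335

end
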